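import Summits.ResolutionOfSingularities.ResolutionOfSingularities.Theorems.FrobeniusLadderFInjectiveMacaulayficationFCForallExists
import HarnessLib.Audit
import HarnessLib

/-!
# FC″ = `FCUnguarded` — the fibre condition WITHOUT the ∀c-guard (crux `FInjectiveMacaulayfication`, chain w45a, door v30)

Support file for crux stmt-ResolutionOfSingularities-15315 (`FrobeniusLadder.FInjectiveMacaulayfication`), chain w45a. [OURS · L1 W4.5a] —
NOT a statement of any manuscript; AI-written, weaker than expert review. Text agreed by NAME AGREEMENT of res-L1-w45a-lead-1
(2026-08-27T15:13:07Z, RULING R13.35 (1)/(2) of res-L1-w45a-plan-1): `FCUnguarded` := the body of `GenericFibreReduction.FCForallExists`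
(p529761, currency (A′)) with the guard block «∀ (n : ℕ) (c : Fin n → X₁.presheaf.stalk η), Ideal.span (Set.range c) ≠ ⊥ → (…).radical =
maximalIdeal _ → (∀ (j : Fin n) (𝔔 : …), …) →» DELETED and nothing else changed — token-identical to the binder `hFCu` of
`L/res-L1-w45a-lead-1/DoorUnguarded.lean` b82fcdcc1123f0ab (527 tokens each; tri-2 FC″ PASS 15:15:00Z transfers). Why the guard goes: the
guarded FC′ delegated the EXISTENCE of a local fix at a bad non-closed `η` to 5e `stub_h4Loc` through §G1, and 5e is refuted on paper at wild
points (wild pinch, RULING R13.34; wild pinch × 𝔸¹ puts such a point at `η`); FC″ re-absorbs that existence in (A′) currency, where the ideal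
of the wild curve through `η` qualifies as `c'` (no radical condition). One definition + the one-line comparison FC″ ⇒ FC′; no `sorry`.
-/

-- single-problem summit: the doubled namespace component is forced
set_option linter.dupNamespace false

noncomputable section

open AlgebraicGeometry CategoryTheory Literature.AlgebraicGeometry.Resolution TopologicalSpace IsLocalRing

namespace Summit.ResolutionOfSingularities.ResolutionOfSingularities.Theorems.FInjectiveMacaulayfication.GenericFibreReduction

open Summit.ResolutionOfSingularities.ResolutionOfSingularities.Theorems.FInjectiveMacaulayfication

/-- §G5d [OURS · L1 W4.5a] **FC″ = `FCUnguarded` (currency (A′), NO guard) — door v30's non-closed stub.** For every admissible pair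
`(X₁, f₁)` (separated, locally of finite type, quasi-compact over a field of characteristic `p`, integral, all stalks CM) and every
NON-CLOSED point `η` that is F-bad while all its proper generizations are F-good, there are an ideal sheaf `J ≠ ⊥` with `η ∈ supp J` and a
LocFix datum `c'` at `η` — `(c') ≠ ⊥`, `(c') ≤ 𝔪_η`, every affine blow-up chart of `(c')` FULL at the primes over `𝔪_η` — with
`stalkIdeal J η = (c')`, such that every blow-up `X₂ → X₁` along `J` is FULL at the non-closed points over `supp J ∖ {η}` (nc) and CM at
the closed points over `supp J` (cl). = `FCForallExists` with its hypothesis «given an `𝔪_η`-primary point-fix `c` …» removed; hence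
STRONGER (`fcForallExists_of_fcUnguarded`). «≤ S?» (tri-2 LEQ-S-AUDIT 31f5a7859335676e): ≤ S_proj+(BP) — implied by a PROJECTIVE
resolution that is an isomorphism over the regular locus together with the blow-up presentation (BP) «a projective birational morphism
onto a quasi-projective integral `X₁` is the blow-up of an ideal sheaf cosupported on the non-iso locus» [Liu2002 §8.1; Hartshorne1977
II.7.17]: `J` := that ideal, `c'` := generators of `J_η`; NOT implied by S literal (a merely proper regular model). Why it might fail: as
FC′ — a special point of `closure {η}` over which no spread of any local fix is CM at the new closed points (kill test K4.6) — plus, newly,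
the existence of a LocFix datum at a wild `η` in dimension ≥ 3. [candidate statement, OURS] -/
@[conjecture] def FCUnguarded : Prop :=
  ∀ (p : ℕ), p.Prime → ∀ (k : Type) [Field k] [CharP k p]
    (X₁ : Scheme.{0}) (f₁ : X₁ ⟶ Spec (.of k)),
      IsSeparated f₁ → LocallyOfFiniteType f₁ → QuasiCompact f₁ → IsIntegral X₁ →
      (∀ x : X₁, (∀ d : ℕ, ringKrullDim (X₁.presheaf.stalk x) = d → ∀ s : Fin d → X₁.presheaf.stalk x,
        (Ideal.span (Set.range s)).radical.IsMaximal → RingTheory.Sequence.IsWeaklyRegular (X₁.presheaf.stalk x) (List.ofFn s))) →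
      ∀ η : X₁, (¬ IsClosed ({η} : Set X₁) ∧ ¬ (∀ d : ℕ, ringKrullDim (X₁.presheaf.stalk η) = d → ∀ s : Fin d → X₁.presheaf.stalk η,
          (Ideal.span (Set.range s)).radical.IsMaximal → ∀ t : X₁.presheaf.stalk η, (∃ e : ℕ, t ^ p ^ e ∈
            Ideal.span ((fun z : X₁.presheaf.stalk η => z ^ p ^ e) '' (Ideal.span (Set.range s) : Set (X₁.presheaf.stalk η)))) →
              t ∈ Ideal.span (Set.range s)) ∧
        ∀ y : X₁, y ⤳ η → y ≠ η → (∀ d : ℕ, ringKrullDim (X₁.presheaf.stalk y) = d → ∀ s : Fin d → X₁.presheaf.stalk y,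
          (Ideal.span (Set.range s)).radical.IsMaximal → ∀ t : X₁.presheaf.stalk y, (∃ e : ℕ, t ^ p ^ e ∈
            Ideal.span ((fun z : X₁.presheaf.stalk y => z ^ p ^ e) '' (Ideal.span (Set.range s) : Set (X₁.presheaf.stalk y)))) →
              t ∈ Ideal.span (Set.range s))) →
      ∃ (J : X₁.IdealSheafData) (n' : ℕ) (c' : Fin n' → X₁.presheaf.stalk η), J ≠ ⊥ ∧ η ∈ (J.support : Set X₁) ∧
      -- the RE-CHOSEN LocFix datum c' at η (currency (A′)): nonzero, inside 𝔪_η, charts FULL over 𝔪_η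
      Ideal.span (Set.range c') ≠ ⊥ ∧ Ideal.span (Set.range c') ≤ maximalIdeal (X₁.presheaf.stalk η) ∧
        (∀ (j : Fin n') (𝔔 : PrimeSpectrum (blowupAlgebra (Ideal.span (Set.range c')) (c' j))),
          𝔔.asIdeal.comap (algebraMap (X₁.presheaf.stalk η) (blowupAlgebra (Ideal.span (Set.range c')) (c' j))) =
            maximalIdeal (X₁.presheaf.stalk η) →
          IsDomain (Localization.AtPrime 𝔔.asIdeal) ∧ ∀ d : ℕ, ringKrullDim (Localization.AtPrime 𝔔.asIdeal) = d →
            ∀ s : Fin d → Localization.AtPrime 𝔔.asIdeal, (Ideal.span (Set.range s)).radical.IsMaximal →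
              RingTheory.Sequence.IsWeaklyRegular (Localization.AtPrime 𝔔.asIdeal) (List.ofFn s) ∧
              ∀ y : Localization.AtPrime 𝔔.asIdeal, (∃ e : ℕ, y ^ p ^ e ∈ Ideal.span ((fun z : Localization.AtPrime 𝔔.asIdeal => z ^ p ^ e) ''
                (Ideal.span (Set.range s) : Set (Localization.AtPrime 𝔔.asIdeal)))) → y ∈ Ideal.span (Set.range s)) ∧
      stalkIdeal J η = Ideal.span (Set.range c') ∧
      (∀ (X₂ : Scheme.{0}) (π : X₂ ⟶ X₁), IsBlowup π J →
        (∀ x : X₂, π.base x ∈ (J.support : Set X₁) → π.base x ≠ η → ¬ IsClosed ({x} : Set X₂) →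
          IsDomain (X₂.presheaf.stalk x) ∧ ∀ d : ℕ, ringKrullDim (X₂.presheaf.stalk x) = d → ∀ s : Fin d → X₂.presheaf.stalk x,
            (Ideal.span (Set.range s)).radical.IsMaximal → RingTheory.Sequence.IsWeaklyRegular (X₂.presheaf.stalk x) (List.ofFn s) ∧
            ∀ t : X₂.presheaf.stalk x, (∃ e : ℕ, t ^ p ^ e ∈ Ideal.span ((fun z : X₂.presheaf.stalk x => z ^ p ^ e) ''
              (Ideal.span (Set.range s) : Set (X₂.presheaf.stalk x)))) → t ∈ Ideal.span (Set.range s)) ∧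
        (∀ x : X₂, π.base x ∈ (J.support : Set X₁) → IsClosed ({x} : Set X₂) →
          ∀ d : ℕ, ringKrullDim (X₂.presheaf.stalk x) = d → ∀ s : Fin d → X₂.presheaf.stalk x,
            (Ideal.span (Set.range s)).radical.IsMaximal → RingTheory.Sequence.IsWeaklyRegular (X₂.presheaf.stalk x) (List.ofFn s)))

/-- §G5e **FC″ ⇒ FC′** (introduce the guard's data and discard it). [folklore] -/
theorem fcForallExists_of_fcUnguarded (h : FCUnguarded) : FCForallExists :=
  fun p hp k _ _ X₁ f₁ hs hft hqc hi hCM η hη _ _ _ _ _ => h p hp k X₁ f₁ hs hft hqc hi hCM η hη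

end Summit.ResolutionOfSingularities.ResolutionOfSingularities.Theorems.FInjectiveMacaulayfication.GenericFibreReduction

end
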